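import Mathlib
import HarnessLib
import Summits.HubbardSuperconductivity.HubbardSuperconductivity.Theorems.KLProgrammeKLRegimeEngineFrameShiftDressingFactorTables

/-!
# K3 gen-8-FLOW (stmt 20437 `KLRegimeEngineV17F2`, stub (C), «(C)-B-ALIAS-L»): CLOSED CHOICES of the envelope parameters `(Ξ, Θ, Φ)` of the Gevrey flow tables

Cell gate-hubbard-kl, seat p2 g15 (successor item (iv) of HOME/HANDOFF «p2 g14» FINAL).  The (B) door with numeral cutoff tables
(`…FrameShiftDressingSupFlowTablesGN._aliasing_gevrey_numeral[4]`, p589357 / its `B₁ = 4` twin) still reads three ENVELOPE hypotheses on free parameters `Ξ, Θ, Φ ≥ 0`: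
`hΞ : ∀ i ≥ 1, A_i ≤ i!·Ξⁱ`, `hΘΦ : ∀ i, A_i ≤ Gfr₀|U|Θ·i!·(2^{10}Φ)ⁱ`, `hδΛ : Gfr₀|U|Θ·16^{−m} ≤ Λ_m/4`, where `A_i` is the flow-piece table
`A_i = Gfr_i·uPow i U` (`i ≤ 4`), `A_i = 2ⁱ·(π⁸/4·2^{i−1}·2^{8(i−1)})·W·U²` (`i ≥ 5`) with `W = curveExtC X₄ G.S 1 + curveExtC X₄ Q.S′ 1·|U| ≥ 0` (p574033/p576420).
This file supplies them in CLOSED FORM — no new parameter, one `U`-door: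

* `flowTableA_le_factorial_mul_pow` — with **`Ξ := 2^{10}(1 + π⁸WU²/2^{11}) + Σ_{j<5} Gfr_j`** and `|U| ≤ 1`: `A_i ≤ i!·Ξⁱ` for every `i ≥ 1`;
* `flowTableA_le_mul_factorial_mul_pow` — with **`Φ := 1`**, **`Θ := 1 + (Σ_{j<5} Gfr_j + π⁸W/2^{11})·|U|/Gfr₀`** (`Gfr₀ > 0`): `A_i ≤ Gfr₀|U|Θ·i!·(2^{10}·1)ⁱ` for every `i`;
* `Gfr_mul_abs_mul_Theta_eq` — `Gfr₀|U|Θ = Gfr₀|U| + (Σ_{j<5} Gfr_j + π⁸W/2^{11})·U²`;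
* **`Gfr_mul_Theta_inv_pow_le_klScale_div_four`** — under the `U`-DOOR `Gfr₀|U| + (Σ_{j<5}Gfr_j + π⁸W/2^{11})U² ≤ 1/128`: `Gfr₀|U|Θ·(16^m)⁻¹ ≤ Λ_m/4` for every `m`
  (`Λ_m = klScale klE0 m = 4^{−m}/32`);
* the nonnegativity lines `Xi_nonneg`, `Theta_nonneg`.

So the closer calls the door with `(Ξ, Θ, Φ) := (Ξ(R,W,U), Θ(R,W,U), 1)` and owes only `|U| ≤ 1`, `0 < Gfr₀` and the `U`-door (a `U ≤ U₀(R, W)` row of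
FrameOK type).  Pure real arithmetic; no definitions; nothing asserts superconductivity.  References: BGM 2006 §3 (3.2) [cite: BenfattoGiulianiMastropietro2006].
-/

noncomputable section

namespace Summit.HubbardSuperconductivity.HubbardSuperconductivity.Theorems.EngineV8

set_option linter.dupNamespace false -- summit = problem name (single-conjunct summit), D-0017

open Real Finset
open Summit.HubbardSuperconductivity.HubbardSuperconductivity.Theorems.KLRegimeSplit
open Summit.HubbardSuperconductivity.HubbardSuperconductivity.Theorems.KLProgrammeLegKernels
open scoped Nat

variable {R : RenConsts} (hR : ∀ j, 0 ≤ R.Gfr j)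
include hR

omit hR in
/-- The power bookkeeping of the high-order rows: `2ⁱ·(π⁸/4·2^{i−1}·2^{8(i−1)})·x = (π⁸x/2^{11})·(2^{10})ⁱ` for `i ≥ 1`. [cite: BenfattoGiulianiMastropietro2006, §3 (3.2)] -/
theorem highRow_eq {i : ℕ} (hi : 1 ≤ i) (x : ℝ) :
    2 ^ i * (Real.pi ^ 8 / 4 * 2 ^ (i - 1) * (2 : ℝ) ^ (8 * (i - 1))) * x = Real.pi ^ 8 * x / 2 ^ 11 * (2 ^ 10) ^ i := by
  obtain ⟨k, rfl⟩ : ∃ k, i = k + 1 := ⟨i - 1, by omega⟩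
  rw [Nat.add_sub_cancel]
  have hA : (2 : ℝ) ^ (k + 1) * 2 ^ k * 2 ^ (8 * k) = 2 ^ (10 * k + 1) := by
    rw [← pow_add, ← pow_add]; congr 1; ring
  have hB : ((2 : ℝ) ^ 10) ^ (k + 1) = 2 ^ (10 * k + 1) * 2 ^ 9 := by
    rw [← pow_mul, ← pow_add]; congr 1
  rw [hB]
  calc 2 ^ (k + 1) * (Real.pi ^ 8 / 4 * 2 ^ k * (2 : ℝ) ^ (8 * k)) * x
      = Real.pi ^ 8 / 4 * ((2 : ℝ) ^ (k + 1) * 2 ^ k * 2 ^ (8 * k)) * x := by ring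
    _ = Real.pi ^ 8 / 4 * 2 ^ (10 * k + 1) * x := by rw [hA]
    _ = Real.pi ^ 8 * x / 2 ^ 11 * (2 ^ (10 * k + 1) * 2 ^ 9) := by ring

/-- **`Ξ` in closed form**: with `Ξ := 2^{10}(1 + π⁸WU²/2^{11}) + Σ_{j<5} Gfr_j` and `|U| ≤ 1`, every row `i ≥ 1` of the flow-piece table is `≤ i!·Ξⁱ`.
[cite: BenfattoGiulianiMastropietro2006, §3 (3.2)] -/
theorem flowTableA_le_factorial_mul_pow {W : ℝ} (hW : 0 ≤ W) {U : ℝ} (hU : |U| ≤ 1) {i : ℕ} (hi : 1 ≤ i) :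
    (if i ≤ 4 then R.Gfr i * uPow i U
      else 2 ^ i * (Real.pi ^ 8 / 4 * 2 ^ (i - 1) * (2 : ℝ) ^ (8 * (i - 1))) * (W * U ^ 2)) ≤
      i ! * (2 ^ 10 * (1 + Real.pi ^ 8 * (W * U ^ 2) / 2 ^ 11) + ∑ j ∈ range 5, R.Gfr j) ^ i := by
  set a : ℝ := Real.pi ^ 8 * (W * U ^ 2) / 2 ^ 11 with ha
  set Ξ : ℝ := 2 ^ 10 * (1 + a) + ∑ j ∈ range 5, R.Gfr j with hΞ
  have ha0 : 0 ≤ a := by rw [ha]; positivity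
  have hS0 : 0 ≤ ∑ j ∈ range 5, R.Gfr j := sum_nonneg fun j _ => hR j
  have hΞ1 : 1 ≤ Ξ := by rw [hΞ]; nlinarith
  have hfac : (1 : ℝ) ≤ i ! := by exact_mod_cast Nat.one_le_iff_ne_zero.2 (Nat.factorial_ne_zero i)
  have hU2 : U ^ 2 ≤ 1 := by
    have : |U| ^ 2 ≤ 1 ^ 2 := pow_le_pow_left₀ (abs_nonneg U) hU 2
    rw [sq_abs, one_pow] at this; exact this
  split_ifs with h4
  · -- rows `1 ≤ i ≤ 4`: `Gfr_i·U² ≤ Gfr_i ≤ Σ Gfr_j ≤ Ξ ≤ Ξⁱ ≤ i!·Ξⁱ`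
    have huP : uPow i U = U ^ 2 := by unfold uPow; rw [if_neg (by omega)]
    rw [huP]
    have h1 : R.Gfr i * U ^ 2 ≤ R.Gfr i := by nlinarith [hR i]
    have h2 : R.Gfr i ≤ ∑ j ∈ range 5, R.Gfr j := single_le_sum (f := fun j => R.Gfr j) (fun j _ => hR j) (mem_range.2 (by omega))
    have h3 : ∑ j ∈ range 5, R.Gfr j ≤ Ξ := by rw [hΞ]; nlinarith
    have h4' : Ξ ≤ Ξ ^ i := le_self_pow₀ hΞ1 (by omega)
    calc R.Gfr i * U ^ 2 ≤ Ξ ^ i := h1.trans (h2.trans (h3.trans h4'))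
      _ ≤ i ! * Ξ ^ i := le_mul_of_one_le_left (by positivity) hfac
  · -- rows `i ≥ 5`: `A_i = a·(2^{10})ⁱ ≤ (2^{10}(1+a))ⁱ ≤ Ξⁱ`
    rw [highRow_eq hi, ← ha]
    have h1 : a * (2 ^ 10) ^ i ≤ (2 ^ 10 * (1 + a)) ^ i := by
      rw [mul_pow]
      have h1a : a ≤ (1 + a) ^ i := by
        have : 1 + a ≤ (1 + a) ^ i := le_self_pow₀ (by linarith) (by omega)
        linarith
      calc a * (2 ^ 10) ^ i = (2 ^ 10) ^ i * a := by ring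
        _ ≤ (2 ^ 10 : ℝ) ^ i * (1 + a) ^ i := by gcongr
    have h2 : (2 ^ 10 * (1 + a)) ^ i ≤ Ξ ^ i := pow_le_pow_left₀ (by positivity) (by rw [hΞ]; linarith) i
    calc a * (2 ^ 10) ^ i ≤ Ξ ^ i := h1.trans h2
      _ ≤ i ! * Ξ ^ i := le_mul_of_one_le_left (by positivity) hfac

/-- `0 ≤ Ξ`. [cite: BenfattoGiulianiMastropietro2006, §3 (3.2)] -/
theorem Xi_nonneg {W : ℝ} (hW : 0 ≤ W) (U : ℝ) : 0 ≤ 2 ^ 10 * (1 + Real.pi ^ 8 * (W * U ^ 2) / 2 ^ 11) + ∑ j ∈ range 5, R.Gfr j := by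
  have hS0 : 0 ≤ ∑ j ∈ range 5, R.Gfr j := sum_nonneg fun j _ => hR j
  positivity

omit hR in
/-- `Gfr₀|U|Θ = Gfr₀|U| + (Σ_{j<5} Gfr_j + π⁸W/2^{11})·U²` for `Θ := 1 + (Σ_{j<5} Gfr_j + π⁸W/2^{11})·|U|/Gfr₀`, `Gfr₀ > 0`.
[cite: BenfattoGiulianiMastropietro2006, §3 (3.2)] -/
theorem Gfr_mul_abs_mul_Theta_eq (hR0 : 0 < R.Gfr 0) (W U : ℝ) :
    R.Gfr 0 * |U| * (1 + ((∑ j ∈ range 5, R.Gfr j) + Real.pi ^ 8 * W / 2 ^ 11) * |U| / R.Gfr 0) =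
      R.Gfr 0 * |U| + ((∑ j ∈ range 5, R.Gfr j) + Real.pi ^ 8 * W / 2 ^ 11) * U ^ 2 := by
  rw [← sq_abs U]
  field_simp

/-- `0 ≤ Θ`. [cite: BenfattoGiulianiMastropietro2006, §3 (3.2)] -/
theorem Theta_nonneg (hR0 : 0 < R.Gfr 0) {W : ℝ} (hW : 0 ≤ W) (U : ℝ) :
    0 ≤ 1 + ((∑ j ∈ range 5, R.Gfr j) + Real.pi ^ 8 * W / 2 ^ 11) * |U| / R.Gfr 0 := by
  have hS0 : 0 ≤ ∑ j ∈ range 5, R.Gfr j := sum_nonneg fun j _ => hR j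
  positivity

/-- **`(Θ, Φ)` in closed form**: with `Φ := 1`, `Θ := 1 + (Σ_{j<5} Gfr_j + π⁸W/2^{11})·|U|/Gfr₀` (`Gfr₀ > 0`), EVERY row `i` of the flow-piece table is
`≤ Gfr₀|U|Θ·i!·(2^{10}·1)ⁱ`. [cite: BenfattoGiulianiMastropietro2006, §3 (3.2)] -/
theorem flowTableA_le_mul_factorial_mul_pow (hR0 : 0 < R.Gfr 0) {W : ℝ} (hW : 0 ≤ W) (U : ℝ) (i : ℕ) :
    (if i ≤ 4 then R.Gfr i * uPow i U
      else 2 ^ i * (Real.pi ^ 8 / 4 * 2 ^ (i - 1) * (2 : ℝ) ^ (8 * (i - 1))) * (W * U ^ 2)) ≤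
      R.Gfr 0 * |U| * (1 + ((∑ j ∈ range 5, R.Gfr j) + Real.pi ^ 8 * W / 2 ^ 11) * |U| / R.Gfr 0) * i ! * (2 ^ 10 * (1 : ℝ)) ^ i := by
  rw [Gfr_mul_abs_mul_Theta_eq hR0, mul_one]
  set S : ℝ := ∑ j ∈ range 5, R.Gfr j with hS
  have hS0 : 0 ≤ S := sum_nonneg fun j _ => hR j
  set T : ℝ := R.Gfr 0 * |U| + (S + Real.pi ^ 8 * W / 2 ^ 11) * U ^ 2 with hT
  have hT0 : 0 ≤ T := by rw [hT]; positivity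
  have hfac : (1 : ℝ) ≤ i ! := by exact_mod_cast Nat.one_le_iff_ne_zero.2 (Nat.factorial_ne_zero i)
  have hpow1 : (1 : ℝ) ≤ (2 ^ 10 : ℝ) ^ i := one_le_pow₀ (by norm_num)
  have hT' : T ≤ T * i ! * (2 ^ 10 : ℝ) ^ i := by
    calc T = T * 1 * 1 := by ring
      _ ≤ T * i ! * (2 ^ 10 : ℝ) ^ i := by gcongr
  split_ifs with h4
  · rcases Nat.eq_zero_or_pos i with h0 | hpos
    · -- row `i = 0`: `Gfr₀·|U| ≤ T`
      subst h0
      have huP : uPow 0 U = |U| := by unfold uPow; rw [if_pos rfl]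
      rw [huP]
      have hx : 0 ≤ (S + Real.pi ^ 8 * W / 2 ^ 11) * U ^ 2 := by positivity
      have h1 : R.Gfr 0 * |U| ≤ T := by rw [hT]; linarith
      exact h1.trans hT'
    · -- rows `1 ≤ i ≤ 4`: `Gfr_i U² ≤ S·U² ≤ T`
      have huP : uPow i U = U ^ 2 := by unfold uPow; rw [if_neg (by omega)]
      rw [huP]
      have h2 : R.Gfr i ≤ S := single_le_sum (f := fun j => R.Gfr j) (fun j _ => hR j) (mem_range.2 (by omega))
      have h1 : R.Gfr i * U ^ 2 ≤ T := by
        rw [hT]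
        have h0 : 0 ≤ R.Gfr 0 * |U| := mul_nonneg (hR 0) (abs_nonneg U)
        have hiS : R.Gfr i * U ^ 2 ≤ S * U ^ 2 := mul_le_mul_of_nonneg_right h2 (sq_nonneg U)
        have hx : 0 ≤ Real.pi ^ 8 * W / 2 ^ 11 * U ^ 2 := by positivity
        nlinarith
      exact h1.trans hT'
  · -- rows `i ≥ 5`: `(π⁸WU²/2^{11})(2^{10})ⁱ ≤ T·(2^{10})ⁱ ≤ T·i!·(2^{10})ⁱ`
    have hi : 1 ≤ i := by omega
    rw [highRow_eq hi]
    have h1 : Real.pi ^ 8 * (W * U ^ 2) / 2 ^ 11 ≤ T := by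
      rw [hT]
      have h0 : 0 ≤ R.Gfr 0 * |U| := mul_nonneg (hR 0) (abs_nonneg U)
      have hx : 0 ≤ S * U ^ 2 := by positivity
      have he : Real.pi ^ 8 * (W * U ^ 2) / 2 ^ 11 = Real.pi ^ 8 * W / 2 ^ 11 * U ^ 2 := by ring
      rw [he]; nlinarith
    calc Real.pi ^ 8 * (W * U ^ 2) / 2 ^ 11 * (2 ^ 10) ^ i ≤ T * (2 ^ 10) ^ i := by gcongr
      _ = T * 1 * (2 ^ 10) ^ i := by ring
      _ ≤ T * i ! * (2 ^ 10) ^ i := by gcongr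

omit hR in
/-- **The `δ ≤ Λ_m/4` line from ONE `U`-door**: if `Gfr₀|U| + (Σ_{j<5} Gfr_j + π⁸W/2^{11})·U² ≤ 1/128` then, with `Θ` as above, `Gfr₀|U|Θ·(16^m)⁻¹ ≤ Λ_m/4` for every
`m` (`Λ_m = klScale klE0 m = (4^m)⁻¹/32`, `16^m ≥ 4^m`). [cite: BenfattoGiulianiMastropietro2006, §3 (3.2)] -/
theorem Gfr_mul_Theta_inv_pow_le_klScale_div_four (hR0 : 0 < R.Gfr 0) {W U : ℝ}
    (hdoor : R.Gfr 0 * |U| + ((∑ j ∈ range 5, R.Gfr j) + Real.pi ^ 8 * W / 2 ^ 11) * U ^ 2 ≤ 1 / 128) (m : ℕ) :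
    R.Gfr 0 * |U| * (1 + ((∑ j ∈ range 5, R.Gfr j) + Real.pi ^ 8 * W / 2 ^ 11) * |U| / R.Gfr 0) * ((16 : ℝ) ^ m)⁻¹ ≤ klScale klE0 m / 4 := by
  rw [Gfr_mul_abs_mul_Theta_eq hR0]
  have h16 : ((16 : ℝ) ^ m)⁻¹ ≤ ((4 : ℝ) ^ m)⁻¹ := by
    apply inv_anti₀ (by positivity)
    exact pow_le_pow_left₀ (by norm_num) (by norm_num) m
  have hΛ : klScale klE0 m / 4 = 1 / 128 * ((4 : ℝ) ^ m)⁻¹ := by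
    simp only [klScale, klE0]; ring
  rw [hΛ]
  have h0 : 0 ≤ ((16 : ℝ) ^ m)⁻¹ := by positivity
  calc (R.Gfr 0 * |U| + ((∑ j ∈ range 5, R.Gfr j) + Real.pi ^ 8 * W / 2 ^ 11) * U ^ 2) * ((16 : ℝ) ^ m)⁻¹
      ≤ 1 / 128 * ((16 : ℝ) ^ m)⁻¹ := mul_le_mul_of_nonneg_right hdoor h0
    _ ≤ 1 / 128 * ((4 : ℝ) ^ m)⁻¹ := by gcongr

end Summit.HubbardSuperconductivity.HubbardSuperconductivity.Theorems.EngineV8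

end
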